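import Summits.Ventures.HodgeRepro2.T6A2Gysin

/-!
# T6A2GysinProofs — sub-claim A2 in kernel: Lemma A4.1.1, Lemma A4.1.2, (S1), (S3), (S4)(ii)

Cell pub-hodge-repro2, Tier 6 (README §10), seat t6-p2. Proof lane: no new definition. Every theorem is
relative to the carrier `CycleTheory` and the displayed hypotheses of `T6A2Gysin.lean` (named in each
statement; nothing else is assumed). Contents, in the numbering of route/T4-A2-p6.md v6 (= TIER4.md §A2):

* `PD_gysin`, `gysin_id`, `gysin_comp` — DEFINITION A4.1.0 (the Gysin map and its functoriality);
* `gysin_mul_pull` — LEMMA A4.1.1(i), the projection formula g_*(α ∪ g^*v) = g_*(α) ∪ v (no sign on even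
  degrees), from Bredon VI.5.2(3),(4) and the commutativity of the even-degree ring;
* `integral_gysin_mul` — LEMMA A4.1.1(ii), ∫_X g_*(α) ∪ v = ∫_Y α ∪ g^*v, from (i) and the naturality of
  the augmentation;
* `gysin_cl`, `gysin_mem_Alg` — LEMMA A4.1.2 (Gysin maps preserve algebraic classes), from Fulton p. 371;
* `one_mem_Alg`, `mul_mem_Alg`, `pull_mem_Alg`, … — the closure properties of Alg(X) of A2.0(c)
  DEFINITION, from Fulton Corollary 19.2(b);
* `z_mem_Alg`, `integral_z_mul` — (S1) = (A4.1.3): z = f_*(1_S) is algebraic and ∫_B z ∪ u = ∫_S f^*u;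
* `tensor_mem_Alg`, `pont_mem_Alg`, `y_mem_Alg` — (S3) = LEMMA A4.3.2 + (A4.3.3): y = z ⋆ θ⁴ is algebraic
  whenever θ is;
* `gamma_mem_Alg`, `Tgamma_eq_pont`, `y_eq_Tgamma`, `Tgamma_mem_Alg` — (S4)(ii) = PROPOSITION A4.4.1(ii):
  γ is algebraic, T_γ(u) = z ⋆ (θ³ ∪ u), y = T_γ(θ), T_γ preserves algebraic classes;
* `exists_model` — a toy instance of the carrier in which ALL displayed hypotheses hold simultaneously
  (README §10.5(ii)(c),(d): the hypotheses are jointly satisfiable; the carrier is not empty).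

Not here: (S2) (Lefschetz (1,1) and the F-compatible classes θ_i — needs the carriers of sub-claim A1 and
the Lefschetz (1,1) display), (S4)(i) y = h_*(ζ⁴) (needs the cross-product facts Bredon VI.5.4 / Fulton
p. 377, to be displayed separately), (S5), (S6).
-/

namespace Summit.Ventures.HodgeRepro2.T6.A2Gysin

universe u

namespace CycleTheory

variable {T : CycleTheory.{u}}

/-- PD_X(α) = α ∩ μ_X, by definition. -/
theorem PD_apply (X : T.Space) (a : T.H X) : T.PD X a = T.cap X a (T.mu X) := rfl

/-- `pdEquiv` is `PD` as a map. -/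
theorem pdEquiv_apply (hPD : T.PoincareDuality) (X : T.Space) (a : T.H X) :
    T.pdEquiv hPD X a = T.PD X a := rfl

/-- DEFINITION A4.1.0, the defining property of the Gysin map: g_*(α) ∩ μ_Y = g_*^{hom}(α ∩ μ_X). -/
theorem PD_gysin (hPD : T.PoincareDuality) {X Y : T.Space} (g : T.Mor X Y) (a : T.H X) :
    T.PD Y (T.gysin hPD g a) = T.pushHom g (T.PD X a) := by
  unfold gysin
  simp only [LinearMap.comp_apply, LinearEquiv.coe_coe]
  rw [← pdEquiv_apply hPD Y, LinearEquiv.apply_symm_apply]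
  rfl

/-- Poincaré duality is injective (half of the displayed hypothesis `PoincareDuality`). -/
theorem PD_injective (hPD : T.PoincareDuality) (X : T.Space) : Function.Injective (T.PD X) :=
  (hPD X).1

/-- The Gysin map is determined by its defining property (uniqueness in A4.1.0). -/
theorem gysin_eq_of_PD_eq (hPD : T.PoincareDuality) {X Y : T.Space} (g : T.Mor X Y) (a : T.H X)
    (b : T.H Y) (h : T.PD Y b = T.pushHom g (T.PD X a)) : T.gysin hPD g a = b :=
  PD_injective hPD Y (by rw [PD_gysin, h])

/-- A4.1.0: (id_X)_* = id. -/
theorem gysin_id (hPD : T.PoincareDuality) (hF : T.Functoriality) (X : T.Space) (a : T.H X) :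
    T.gysin hPD (T.id X) a = a :=
  gysin_eq_of_PD_eq hPD _ _ _ (by rw [hF.1 X]; rfl)

/-- A4.1.0: functoriality (g ∘ f)_* = g_* ∘ f_*, from the functoriality of g_*^{hom}. -/
theorem gysin_comp (hPD : T.PoincareDuality) (hF : T.Functoriality) {X Y Z : T.Space}
    (g : T.Mor Y Z) (f : T.Mor X Y) (a : T.H X) :
    T.gysin hPD (T.comp g f) a = T.gysin hPD g (T.gysin hPD f a) :=
  gysin_eq_of_PD_eq hPD _ _ _ (by rw [PD_gysin, PD_gysin, hF.2.1 X Y Z g f]; rfl)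

/-- LEMMA A4.1.1(i) (projection formula): g_*(α ∪ g^*v) = g_*(α) ∪ v. On even degrees no sign occurs; the
inputs are Bredon VI.5.2(3) and (4) (displayed as `BredonCapProduct`) and the commutativity of the
even-degree ring (graded commutativity, Bredon VI.4.5(4), with sign +1). -/
theorem gysin_mul_pull (hPD : T.PoincareDuality) (hCap : T.BredonCapProduct) {X Y : T.Space}
    (g : T.Mor X Y) (a : T.H X) (v : T.H Y) :
    T.gysin hPD g (a * T.pull g v) = T.gysin hPD g a * v := by
  apply gysin_eq_of_PD_eq
  rw [PD_apply, PD_apply, mul_comm a, hCap.2.1 X (T.pull g v) a, hCap.2.2 X Y g v,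
    mul_comm (T.gysin hPD g a) v, hCap.2.1 Y v]
  congr 1
  rw [← PD_apply, ← PD_apply, PD_gysin]

/-- LEMMA A4.1.1(ii): ∫_Y g_*(α) ∪ v = ∫_X α ∪ g^*v, from (i) and the naturality of the augmentation. -/
theorem integral_gysin_mul (hPD : T.PoincareDuality) (hCap : T.BredonCapProduct)
    (hAug : T.AugmentationNatural) {X Y : T.Space} (g : T.Mor X Y) (a : T.H X) (v : T.H Y) :
    T.integral Y (T.gysin hPD g a * v) = T.integral X (a * T.pull g v) := by
  rw [← gysin_mul_pull hPD hCap]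
  unfold integral
  rw [LinearMap.comp_apply, PD_gysin, ← LinearMap.comp_apply (T.aug Y), hAug X Y g]
  rfl

/-- LEMMA A4.1.2, first form: g_*(cl^X(y)) = cl^Y(g_*y) — Fulton's "cl commutes with push-forward for
proper morphisms" read through Poincaré duality. -/
theorem gysin_cl (hPD : T.PoincareDuality) (hF1 : T.FultonProperPushForward) {X Y : T.Space}
    (g : T.Mor X Y) (y : T.Cyc X) :
    T.gysin hPD g (T.cl X y) = T.cl Y (T.cycPush g y) :=
  gysin_eq_of_PD_eq hPD _ _ _ (hF1 X Y g y).symm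

/-- LEMMA A4.1.2: Gysin maps preserve algebraic classes, g_* Alg(X) ⊂ Alg(Y). -/
theorem gysin_mem_Alg (hPD : T.PoincareDuality) (hF1 : T.FultonProperPushForward) {X Y : T.Space}
    (g : T.Mor X Y) {a : T.H X} (ha : a ∈ T.Alg X) : T.gysin hPD g a ∈ T.Alg Y := by
  obtain ⟨y, rfl⟩ := ha
  exact ⟨T.cycPush g y, (gysin_cl hPD hF1 g y).symm⟩

/-- A2.0(c): 1 = cl^X(1) ∈ Alg(X) (cl is a unital ring homomorphism, Fulton Cor. 19.2(b)). -/
theorem one_mem_Alg (hR : T.FultonCycleClassRingHom) (X : T.Space) : (1 : T.H X) ∈ T.Alg X :=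
  ⟨1, hR.1 X⟩

/-- A2.0(c): Alg(X) is closed under the cup product (Fulton Cor. 19.2(b)). -/
theorem mul_mem_Alg (hR : T.FultonCycleClassRingHom) {X : T.Space} {a b : T.H X} (ha : a ∈ T.Alg X)
    (hb : b ∈ T.Alg X) : a * b ∈ T.Alg X := by
  obtain ⟨y, rfl⟩ := ha
  obtain ⟨y', rfl⟩ := hb
  exact ⟨y * y', hR.2.1 X y y'⟩

/-- A2.0(c): Alg(X) is closed under addition (cl is additive). -/
theorem add_mem_Alg {X : T.Space} {a b : T.H X} (ha : a ∈ T.Alg X) (hb : b ∈ T.Alg X) :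
    a + b ∈ T.Alg X := by
  obtain ⟨y, rfl⟩ := ha
  obtain ⟨y', rfl⟩ := hb
  exact ⟨y + y', map_add _ _ _⟩

/-- A2.0(c): Alg(X) is closed under rational scalars (the ℚ-span). -/
theorem smul_mem_Alg {X : T.Space} (q : ℚ) {a : T.H X} (ha : a ∈ T.Alg X) : q • a ∈ T.Alg X := by
  obtain ⟨y, rfl⟩ := ha
  exact ⟨q • y, map_smul _ _ _⟩

/-- A2.0(c): Alg(X) is closed under powers. -/
theorem pow_mem_Alg (hR : T.FultonCycleClassRingHom) {X : T.Space} {a : T.H X} (ha : a ∈ T.Alg X)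
    (n : ℕ) : a ^ n ∈ T.Alg X := by
  induction n with
  | zero => simpa using one_mem_Alg hR X
  | succ n ih => rw [pow_succ]; exact mul_mem_Alg hR ih ha

/-- A2.0(c): pull-backs preserve algebraic classes, g^* Alg(Y) ⊂ Alg(X) (Fulton Cor. 19.2(b),
"contravariant for morphisms of non-singular varieties"). -/
theorem pull_mem_Alg (hR : T.FultonCycleClassRingHom) {X Y : T.Space} (g : T.Mor X Y) {a : T.H Y}
    (ha : a ∈ T.Alg Y) : T.pull g a ∈ T.Alg X := by
  obtain ⟨y, rfl⟩ := ha
  exact ⟨T.cycPull g y, (hR.2.2 X Y g y).symm⟩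

/-- The toy model used as a consistency witness (README §10.5(ii)(c),(d)): one space, H = H_* = A^* = ℚ,
every induced map the identity, cap = multiplication, μ = 1, ε = id, cl = id. It is NOT a statement about
varieties; it only shows that the carrier is inhabited and the displayed hypotheses are jointly
satisfiable. -/
noncomputable def toyModel : CycleTheory.{0} where
  Space := Unit
  Mor := fun _ _ => Unit
  id := fun _ => ()
  comp := fun _ _ => ()
  H := fun _ => ℚ
  instCommRingH := fun _ => inferInstance
  instAlgebraH := fun _ => inferInstance
  Hom := fun _ => ℚ
  instAddCommGroupHom := fun _ => inferInstance
  instModuleHom := fun _ => inferInstance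
  cap := fun _ => LinearMap.mul ℚ ℚ
  pull := fun _ => LinearMap.id
  pushHom := fun _ => LinearMap.id
  mu := fun _ => 1
  aug := fun _ => LinearMap.id
  Cyc := fun _ => ℚ
  instCommRingCyc := fun _ => inferInstance
  instAlgebraCyc := fun _ => inferInstance
  cl := fun _ => LinearMap.id
  cycPush := fun _ => LinearMap.id
  cycPull := fun _ => LinearMap.id

/-- README §10.5(ii)(c),(d): the carrier is inhabited and the seven displayed hypotheses hold
simultaneously in the toy model. -/
theorem toyModel_hypotheses : toyModel.Functoriality ∧ toyModel.BredonCupProduct ∧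
    toyModel.BredonCapProduct ∧ toyModel.AugmentationNatural ∧ toyModel.PoincareDuality ∧
    toyModel.FultonProperPushForward ∧ toyModel.FultonCycleClassRingHom := by
  refine ⟨?_, ?_, ?_, ?_, ?_, ?_, ?_⟩
  · exact ⟨fun _ => rfl, fun _ _ _ _ _ => rfl, fun _ => rfl, fun _ _ _ _ _ => rfl⟩
  · exact fun _ _ _ => ⟨fun _ _ => rfl, rfl⟩
  · exact ⟨fun _ (γ : ℚ) => one_mul γ, fun _ (α β γ : ℚ) => mul_assoc α β γ,
      fun _ _ _ _ _ => rfl⟩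
  · exact fun _ _ _ => rfl
  · intro _
    refine ⟨fun (a b : ℚ) (h : a * 1 = b * 1) => ?_, fun (b : ℚ) => ⟨b, mul_one b⟩⟩
    exact (mul_one a).symm.trans (h.trans (mul_one b))
  · intro _ _ _ _
    rfl
  · exact ⟨fun _ => rfl, fun _ _ _ => rfl, fun _ _ _ _ => rfl⟩

/-- README §10.5(ii)(c),(d), existential form: a carrier in which all displayed hypotheses hold. -/
theorem exists_model : ∃ T : CycleTheory.{0}, T.Functoriality ∧ T.BredonCupProduct ∧
    T.BredonCapProduct ∧ T.AugmentationNatural ∧ T.PoincareDuality ∧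
    T.FultonProperPushForward ∧ T.FultonCycleClassRingHom :=
  ⟨toyModel, toyModel_hypotheses⟩

end CycleTheory

namespace A2Situation

variable {T : CycleTheory.{u}} (σ : A2Situation T) (hPD : T.PoincareDuality)

/-- (S1) = (A4.1.3): z = f_*(1_S) is algebraic, z ∈ Alg(B). -/
theorem z_mem_Alg (hF1 : T.FultonProperPushForward) (hR : T.FultonCycleClassRingHom) :
    σ.z hPD ∈ T.Alg σ.B :=
  CycleTheory.gysin_mem_Alg hPD hF1 σ.f (CycleTheory.one_mem_Alg hR σ.S)

/-- (S1) = (A4.1.1): ∫_B z ∪ u = ∫_S f^*u for every u (here u ∈ H^{even}(B, ℚ); the ℂ-linear extension is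
formal). -/
theorem integral_z_mul (hCap : T.BredonCapProduct) (hAug : T.AugmentationNatural) (u : T.H σ.B) :
    T.integral σ.B (σ.z hPD * u) = T.integral σ.S (T.pull σ.f u) := by
  unfold z
  rw [CycleTheory.integral_gysin_mul hPD hCap hAug, one_mul]

/-- LEMMA A4.3.2 (cross products of algebraic classes are algebraic): a ⊗ b = pr₁^*a ∪ pr₂^*b ∈ Alg(B × B)
for a, b ∈ Alg(B). -/
theorem tensor_mem_Alg (hR : T.FultonCycleClassRingHom) {a b : T.H σ.B} (ha : a ∈ T.Alg σ.B)
    (hb : b ∈ T.Alg σ.B) : σ.tensor a b ∈ T.Alg σ.BB :=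
  CycleTheory.mul_mem_Alg hR (CycleTheory.pull_mem_Alg hR σ.pr1 ha)
    (CycleTheory.pull_mem_Alg hR σ.pr2 hb)

/-- (A4.3.3): the Pontryagin product of algebraic classes is algebraic. -/
theorem pont_mem_Alg (hF1 : T.FultonProperPushForward) (hR : T.FultonCycleClassRingHom)
    {a b : T.H σ.B} (ha : a ∈ T.Alg σ.B) (hb : b ∈ T.Alg σ.B) : σ.pont hPD a b ∈ T.Alg σ.B :=
  CycleTheory.gysin_mem_Alg hPD hF1 σ.m (σ.tensor_mem_Alg hR ha hb)

/-- (S3) = (A4.3.3): y = z ⋆ θ⁴ ∈ Alg(B) whenever θ ∈ Alg(B). -/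
theorem y_mem_Alg (hF1 : T.FultonProperPushForward) (hR : T.FultonCycleClassRingHom) {θ : T.H σ.B}
    (hθ : θ ∈ T.Alg σ.B) : σ.y hPD θ ∈ T.Alg σ.B :=
  σ.pont_mem_Alg hPD hF1 hR (σ.z_mem_Alg hPD hF1 hR) (CycleTheory.pow_mem_Alg hR hθ 4)

/-- PROPOSITION A4.4.1(ii): the correspondence γ = φ_*(z ⊗ θ³) is algebraic whenever θ is. -/
theorem gamma_mem_Alg (hF1 : T.FultonProperPushForward) (hR : T.FultonCycleClassRingHom)
    {θ : T.H σ.B} (hθ : θ ∈ T.Alg σ.B) : σ.gamma hPD θ ∈ T.Alg σ.BB :=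
  CycleTheory.gysin_mem_Alg hPD hF1 σ.phi
    (σ.tensor_mem_Alg hR (σ.z_mem_Alg hPD hF1 hR) (CycleTheory.pow_mem_Alg hR hθ 3))

/-- PROPOSITION A4.4.1(ii): T_γ(u) = z ⋆ (θ³ ∪ u) for every u — the projection formula for φ, pr₁ ∘ φ = pr₂,
pr₂ ∘ φ = m, and the functoriality of the Gysin map. -/
theorem Tgamma_eq_pont (hF : T.Functoriality) (hCap : T.BredonCapProduct)
    (hCup : T.BredonCupProduct) (θ u : T.H σ.B) :
    σ.Tgamma hPD θ u = σ.pont hPD (σ.z hPD) (θ ^ 3 * u) := by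
  unfold Tgamma gamma pont
  have h1 : T.pull σ.phi (T.pull σ.pr1 u) = T.pull σ.pr2 u := by
    rw [← LinearMap.comp_apply, ← hF.2.2.2 σ.BB σ.BB σ.B σ.pr1 σ.phi, σ.pr1_phi]
  rw [← CycleTheory.gysin_mul_pull hPD hCap, h1, ← CycleTheory.gysin_comp hPD hF, σ.pr2_phi]
  congr 1
  unfold tensor
  rw [mul_assoc, ← (hCup σ.BB σ.B σ.pr2).1]

/-- PROPOSITION A4.4.1(ii): y = T_γ(θ). -/
theorem y_eq_Tgamma (hF : T.Functoriality) (hCap : T.BredonCapProduct) (hCup : T.BredonCupProduct)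
    (θ : T.H σ.B) : σ.y hPD θ = σ.Tgamma hPD θ θ := by
  rw [σ.Tgamma_eq_pont hPD hF hCap hCup, ← pow_succ]
  rfl

/-- PROPOSITION A4.4.1(ii): T_γ maps Alg(B) into Alg(B). -/
theorem Tgamma_mem_Alg (hF1 : T.FultonProperPushForward) (hR : T.FultonCycleClassRingHom)
    {θ u : T.H σ.B} (hθ : θ ∈ T.Alg σ.B) (hu : u ∈ T.Alg σ.B) : σ.Tgamma hPD θ u ∈ T.Alg σ.B :=
  CycleTheory.gysin_mem_Alg hPD hF1 σ.pr2
    (CycleTheory.mul_mem_Alg hR (σ.gamma_mem_Alg hPD hF1 hR hθ) (CycleTheory.pull_mem_Alg hR σ.pr1 hu))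

end A2Situation

end Summit.Ventures.HodgeRepro2.T6.A2Gysin
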